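/-
Copyright (c) 2026 the pub-hodgecm-mathlib formalisation cell (harness21).  Prover seat hodgecm-mathlib-LH4-p09 (g9), req620 Track A «(D-RAM) FOUR-FRAME» squad
(STAGE-1b, the (β-BAL) TABLE of `stub_law_cleanSgn`; dealer∕pen LH4-plan (g13) WORD #110 «THE PRODUCT TRANSVERSAL» (κG lineage) for LH4-p13 (g8)'s ★ p860847 and
LH4-p05 (g8)'s TABLE assembly; SIG `SIG-ProductTransversal.v1` 8e8be83d), 2026-09-04.  FILE 1 of 2.
-/
import Summits.HodgeConjecture.HodgeConjecture.Theorems.F0P3cDyRamDiagonalKappaGluedClass   -- ★ κG §4 (this lineage): `mem_fixedUnitStabilizer_glued_rep_iff`; brings ★ `…GluedFixedStabiliser` (`mem_latticeStabilizer_latt_glued_exp_iff`), ★ DEFS `…DiagonalTorusDefs`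
import Literature.NumberTheory.Automorphic.UnitaryLatticeTreeWeightedGauss                 -- ★ `v_eq_one_of_v_sub_one_lt_one` (`|a − 1| < 1 ⟹ |a| = 1`)
import HarnessLib

/-!
# Crux `H413`, line LH4 «(D-RAM) FOUR-FRAME» — STAGE-1b, the (β-BAL) TABLE: «THE PRODUCT NORM SUBGROUP OF THE GLUED REPRESENTATIVE» (FILE 1 of 2) — the deep ratio subgroup
# `D(ρ,t)` of the unit torus and `N₀ = N(D) ≤ N′ = N(S̃(latt V(1,1,g)))`, ★ p860847's binder `hN₀` for a PRODUCT-shaped `N₀`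

Cell `hodgecm-mathlib` (D-0151), FLOOR 0, crux item H413 = `stmt-HodgeConjecture-24833`, route of record `HCCMUnconditional`; squad F0∕P3c∕LH4; lane
`--supports stmt-HodgeConjecture-24833 --as helper` (count-neutral; pays NO tier-0 row).  THEOREMS ONLY (no `def`, no instance, no notation, no `sorry`, default heartbeats).
DATUM-FREE valuation algebra (`K : Type` with `Valued K ℤᵐ⁰`, any `σ : K →+* K`, `0 < |ϖ| ≤ 1`; no residue field, no `|2|`, no self-duality).

WHY.  ★ p860847 `two_mul_card_mul_labelledOddCount_eq_sum_of_classSign` (LH4-p13 (g8), (L-lab-20d)) computes the labelled odd count of the glued representative `M₀ = latt V(1,1,g)`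
(`V = (1 0 0; 1 ϖ^ρ 0; 1+g ϖ^ρ ϖ^{2ρ+2t})`, `|g| = |ϖ|^{2t}`) from a transversal of `S_F(M₀) ∕ N₀` for ANY subgroup `N₀ ≤ N′ = N(S̃(M₀))`; MEMO-B2b2 65e7cd47 §2 shows `S_F ∕ N′`
itself is SHEARED, §3 asks for a PRODUCT-shaped `N₀`.  In the multiplicative coordinates `(x, p, y) = (u₀, u₁∕u₀, u₂∕u₁)` the choice
`N₀ := N(U_E) × N(U_E^{[2ρ]}) × N(U_E^{[2ρ+2t]})` (the `y`-factor taken DEEP; MEMO §3's `N(U_E^{[ρ+2t]})`-factor is not multiplicatively closed against the `p`-factor) is a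
subgroup of `N′`; it is `N(D)` for the DEEP RATIO SUBGROUP `D(ρ,t) = {s ∈ 𝒯 : |s₁ − s₀| ≤ |ϖ|^{2ρ}, |s₂ − s₁| ≤ |ϖ|^{2ρ+2t}}` of the unit torus.  No top-level `def`: `D` enters
every head through a membership `iff` (★ κG's `hcoset` style).
* §0 valuation helpers: units near `1` and their products ∕ inverses ∕ quotients ∕ norms stay near `1`; the unit `T(y) = y + g⁻¹(y − 1)` (`≡ 1 (mod ϖ^ρ)` for `y ∈ U^{[ρ+2t]}`,
  `|ϖ|^{−2t}`-Lipschitz) — the corner letter of ★ κG §4 `mem_fixedUnitStabilizer_glued_rep_iff` in the `(x,p,y)` coordinates (FILE 2 consumes these).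
* §1 `exists_deepRatioSubgroup` (the subgroup, built in the proof); `deepRatioSubgroup_le_unitStabilizer_glued_rep` — `D ≤ S̃(latt V)` (★ `mem_latticeStabilizer_latt_glued_exp_iff`:
  (a), (b) a fortiori, corner `|(s₂−s₁) + g(s₂−s₀)| ≤ |ϖ|^{2ρ+2t}`); `map_deepRatioSubgroup_le_map_unitStabilizer_glued_rep` — `N₀ := D.map (unitNormMap σ 3) ≤ N′`.
FILE 2 (`F0P3cDyRamGluedProductTransversal`): the product transversal `R₀ = A₀ × A_β × A_γ` of `S_F(latt V) ∕ N₀` (★ p860847's `hR₀S`, `hR₀`) and its cardinality.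
HONEST LABEL.  Count-neutral valuation∕group bookkeeping; nothing printed is asserted; no census law is stated; (β-BAL), (β), β₂ and the T₊ row stay OPEN; `HC_CM` is proved only
modulo the 7 printed citations (2 remaining named inputs: hLiu418 = `stmt-HodgeConjecture-24832`, h413 = `stmt-HodgeConjecture-24833`) until rung 0 closes.
## References
* [Kottwitz1986BaseChangeUnits] R. E. Kottwitz, *Base change for unit elements of Hecke algebras*, Compositio Math. 60 (1986): §1 pp. 240–241 (orbital integrals as weighted lattice counts).
* [Serre1979] J.-P. Serre, *Local Fields*, GTM 67 (1979): Ch. V §2–§3 (norm groups of the unit filtration of a quadratic extension; index two on the fixed units).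
-/

set_option autoImplicit false

noncomputable section

namespace Summit.HodgeConjecture.HodgeConjecture.Cruxes.H413.F0P3cDyRamGluedDeepRatioSubgroup

open Matrix
open Literature.NumberTheory.Automorphic Literature.NumberTheory.Automorphic.HermitianLattice Literature.NumberTheory.Automorphic.UnitaryGroup
open Literature.NumberTheory.Automorphic.UnitaryLatticeTree Literature.NumberTheory.Automorphic.UnitaryThreeFourFrame
open Summit.HodgeConjecture.HodgeConjecture.Cruxes.H413.F0P3cDyRamDiagonalTorusDefs
open Summit.HodgeConjecture.HodgeConjecture.Cruxes.H413.F0P3cDyRamDiagonalKappaGluedClass (mem_fixedUnitStabilizer_glued_rep_iff)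
open Summit.HodgeConjecture.HodgeConjecture.Cruxes.H413.F0P3cDyRamDiagonalGluedFixedStabiliser (mem_latticeStabilizer_latt_glued_exp_iff)
open scoped Valued WithZero Matrix MatrixGroups

variable {K : Type} [Field K] [Valued K ℤᵐ⁰]

/-! ## §0 Valuation helpers: units near `1`, norms of units near `1`, the unit `T(y) = y + g⁻¹(y − 1)` -/

/-- `0 < |ϖ| < 1 ⟹ |ϖ|^k < 1` for `k ≠ 0`. [cite: Serre1979, Ch. V §2] -/
theorem v_pow_lt_one {ϖ : K} (hϖ1 : Valued.v ϖ < 1) {k : ℕ} (hk : k ≠ 0) : Valued.v ϖ ^ k < 1 :=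
  pow_lt_one₀ zero_le hϖ1 hk

/-- A product of two elements of `U^{[k]}` is in `U^{[k]}`: `|a − 1|, |b − 1| ≤ r`, `|a| ≤ 1` ⟹ `|ab − 1| ≤ r`. [cite: Serre1979, Ch. V §2] -/
theorem v_mul_sub_one_le {a b : K} {r : ℤᵐ⁰} (ha1 : Valued.v a ≤ 1) (ha : Valued.v (a - 1) ≤ r) (hb : Valued.v (b - 1) ≤ r) :
    Valued.v (a * b - 1) ≤ r := by
  rw [show a * b - 1 = a * (b - 1) + (a - 1) by ring]
  refine Valuation.map_add_le _ ?_ ha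
  rw [map_mul]
  exact (mul_le_of_le_one_left zero_le ha1).trans hb

/-- The inverse of an element of `U^{[k]}` is in `U^{[k]}`: `|a| = 1`, `|a − 1| ≤ r` ⟹ `|a⁻¹ − 1| ≤ r`. [cite: Serre1979, Ch. V §2] -/
theorem v_inv_sub_one_le {a : K} {r : ℤᵐ⁰} (ha1 : Valued.v a = 1) (ha : Valued.v (a - 1) ≤ r) : Valued.v (a⁻¹ - 1) ≤ r := by
  have ha0 : a ≠ 0 := fun h0 => by rw [h0, map_zero] at ha1; exact zero_ne_one ha1
  rw [show a⁻¹ - 1 = -(a⁻¹ * (a - 1)) by field_simp; ring, Valuation.map_neg, map_mul, map_inv₀, ha1, inv_one, one_mul]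
  exact ha

/-- A quotient of two elements of `U^{[k]}`: `|a − 1|, |b − 1| ≤ r`, `|b| = 1` ⟹ `|a∕b − 1| ≤ r`. [cite: Serre1979, Ch. V §2] -/
theorem v_div_sub_one_le {a b : K} {r : ℤᵐ⁰} (ha : Valued.v (a - 1) ≤ r) (hb1 : Valued.v b = 1) (hb : Valued.v (b - 1) ≤ r) :
    Valued.v (a / b - 1) ≤ r := by
  rw [div_eq_mul_inv, mul_comm]
  exact v_mul_sub_one_le (by rw [map_inv₀, hb1, inv_one]) (v_inv_sub_one_le hb1 hb) ha

/-- **THE NORM OF A UNIT NEAR `1` IS NEAR `1`**: for isometric `σ`, `|s − 1| ≤ r < 1` ⟹ `|s·σs − 1| ≤ r` (and `|s| = 1`). [cite: Serre1979, Ch. V §2] -/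
theorem v_mul_map_sub_one_le {σ : K →+* K} (hvσ : ∀ a, Valued.v (σ a) = Valued.v a) {s : K} {r : ℤᵐ⁰} (hr : r < 1) (hs : Valued.v (s - 1) ≤ r) :
    Valued.v (s * σ s - 1) ≤ r := by
  have hs1 : Valued.v s = 1 := v_eq_one_of_v_sub_one_lt_one (hs.trans_lt hr)
  refine v_mul_sub_one_le hs1.le hs ?_
  rw [show σ s - 1 = σ (s - 1) by rw [map_sub, map_one], hvσ]
  exact hs

/-- **`T(y) = y + g⁻¹(y − 1)` IS A UNIT `≡ 1 (mod ϖ^ρ)`** for `|g| = |ϖ|^{2t}` and `|y − 1| ≤ |ϖ|^{ρ+2t}` (`0 < |ϖ| ≤ 1`). [cite: Kottwitz1986BaseChangeUnits, §1 pp. 240–241] -/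
theorem v_T_sub_one_le {ϖ : K} (hϖ0 : ϖ ≠ 0) (hϖ1 : Valued.v ϖ ≤ 1) (ρ t : ℕ) {g : K} (hg : Valued.v g = Valued.v ϖ ^ (2 * t)) {y : K}
    (hy : Valued.v (y - 1) ≤ Valued.v ϖ ^ (ρ + 2 * t)) : Valued.v (y + g⁻¹ * (y - 1) - 1) ≤ Valued.v ϖ ^ ρ := by
  have hvϖ : 0 < Valued.v ϖ := (Valuation.pos_iff _).2 hϖ0
  have hϖt : Valued.v ϖ ^ (2 * t) ≠ 0 := pow_ne_zero _ hvϖ.ne'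
  rw [show y + g⁻¹ * (y - 1) - 1 = g⁻¹ * (y - 1) + (y - 1) by ring]
  refine Valuation.map_add_le _ ?_ (hy.trans (pow_le_pow_right_of_le_one' hϖ1 (Nat.le_add_right ρ (2 * t))))
  rw [map_mul, map_inv₀, hg]
  calc (Valued.v ϖ ^ (2 * t))⁻¹ * Valued.v (y - 1) ≤ (Valued.v ϖ ^ (2 * t))⁻¹ * Valued.v ϖ ^ (ρ + 2 * t) := mul_le_mul_right hy _
    _ = Valued.v ϖ ^ ρ := by rw [pow_add, mul_comm (Valued.v ϖ ^ ρ), ← mul_assoc, inv_mul_cancel₀ hϖt, one_mul]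

/-- `T` is `|ϖ|^{−2t}`-LIPSCHITZ: `|y′ − y| ≤ |ϖ|^{2ρ+2t}` ⟹ `|T(y′) − T(y)| ≤ |ϖ|^{2ρ}`. [cite: Kottwitz1986BaseChangeUnits, §1 pp. 240–241] -/
theorem v_T_sub_T_le {ϖ : K} (hϖ0 : ϖ ≠ 0) (hϖ1 : Valued.v ϖ ≤ 1) (ρ t : ℕ) {g : K} (hg : Valued.v g = Valued.v ϖ ^ (2 * t)) {y y' : K}
    (hyy : Valued.v (y' - y) ≤ Valued.v ϖ ^ (2 * ρ + 2 * t)) :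
    Valued.v ((y' + g⁻¹ * (y' - 1)) - (y + g⁻¹ * (y - 1))) ≤ Valued.v ϖ ^ (2 * ρ) := by
  have hvϖ : 0 < Valued.v ϖ := (Valuation.pos_iff _).2 hϖ0
  have hϖt : Valued.v ϖ ^ (2 * t) ≠ 0 := pow_ne_zero _ hvϖ.ne'
  rw [show (y' + g⁻¹ * (y' - 1)) - (y + g⁻¹ * (y - 1)) = g⁻¹ * (y' - y) + (y' - y) by ring]
  refine Valuation.map_add_le _ ?_ (hyy.trans (pow_le_pow_right_of_le_one' hϖ1 (Nat.le_add_right _ _)))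
  rw [map_mul, map_inv₀, hg]
  calc (Valued.v ϖ ^ (2 * t))⁻¹ * Valued.v (y' - y) ≤ (Valued.v ϖ ^ (2 * t))⁻¹ * Valued.v ϖ ^ (2 * ρ + 2 * t) := mul_le_mul_right hyy _
    _ = Valued.v ϖ ^ (2 * ρ) := by rw [pow_add, mul_comm (Valued.v ϖ ^ (2 * ρ)), ← mul_assoc, inv_mul_cancel₀ hϖt, one_mul]

/-! ## §1 The deep ratio subgroup `D(ρ,t)` and `N₀ = N(D) ≤ N′ = N(S̃(latt V))` -/

/-- **(PT-1) THE DEEP RATIO SUBGROUP EXISTS**: `D(ρ,t) = {s ∈ (Kˣ)³ : |s_i| = 1, |s₁ − s₀| ≤ |ϖ|^{2ρ}, |s₂ − s₁| ≤ |ϖ|^{2ρ+2t}}` is a subgroup of `(Kˣ)³` (the two ball conditions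
are conditions on the ratios `s₁∕s₀ ∈ U^{[2ρ]}`, `s₂∕s₁ ∈ U^{[2ρ+2t]}` of units, hence multiplicative).  Stated as an existence so that no `def` enters a theorems file; every later head
takes `D` through this membership `iff`. [cite: Serre1979, Ch. V §2] [cite: Kottwitz1986BaseChangeUnits, §1 pp. 240–241] -/
theorem exists_deepRatioSubgroup (ϖ : K) (ρ t : ℕ) :
    ∃ D : Subgroup (Fin 3 → Kˣ), ∀ s : Fin 3 → Kˣ, s ∈ D ↔
      (∀ i, Valued.v (s i : K) = 1) ∧ Valued.v ((s 1 : K) - s 0) ≤ Valued.v ϖ ^ (2 * ρ) ∧ Valued.v ((s 2 : K) - s 1) ≤ Valued.v ϖ ^ (2 * ρ + 2 * t) := by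
  refine ⟨Subgroup.mk (Submonoid.mk (Subsemigroup.mk (setOf fun s : Fin 3 → Kˣ => (∀ i, Valued.v (s i : K) = 1) ∧
      Valued.v ((s 1 : K) - s 0) ≤ Valued.v ϖ ^ (2 * ρ) ∧ Valued.v ((s 2 : K) - s 1) ≤ Valued.v ϖ ^ (2 * ρ + 2 * t)) ?_) ?_) ?_, fun s => Iff.rfl⟩
  · intro s w hs hw
    obtain ⟨hs1, hsa, hsb⟩ := hs
    obtain ⟨hw1, hwa, hwb⟩ := hw
    refine ⟨fun i => by rw [Pi.mul_apply, Units.val_mul, map_mul, hs1 i, hw1 i, mul_one], ?_, ?_⟩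
    · have e : (((s * w) 1 : Kˣ) : K) - ((s * w) 0 : Kˣ) = (s 1 : K) * ((w 1 : K) - w 0) + (w 0 : K) * ((s 1 : K) - s 0) := by
        simp only [Pi.mul_apply, Units.val_mul]; ring
      rw [e]
      refine Valuation.map_add_le _ ?_ ?_
      · rw [map_mul, hs1 1, one_mul]; exact hwa
      · rw [map_mul, hw1 0, one_mul]; exact hsa
    · have e : (((s * w) 2 : Kˣ) : K) - ((s * w) 1 : Kˣ) = (s 2 : K) * ((w 2 : K) - w 1) + (w 1 : K) * ((s 2 : K) - s 1) := by
        simp only [Pi.mul_apply, Units.val_mul]; ring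
      rw [e]
      refine Valuation.map_add_le _ ?_ ?_
      · rw [map_mul, hs1 2, one_mul]; exact hwb
      · rw [map_mul, hw1 1, one_mul]; exact hsb
  · refine ⟨fun i => by simp, ?_, ?_⟩ <;> simp
  · intro s hs
    obtain ⟨hs1, hsa, hsb⟩ := hs
    have h0 : ∀ i, ((s i : Kˣ) : K) ≠ 0 := fun i => (s i).ne_zero
    refine ⟨fun i => by rw [Pi.inv_apply, Units.val_inv_eq_inv_val, map_inv₀, hs1 i, inv_one], ?_, ?_⟩
    · have e : (((s⁻¹) 1 : Kˣ) : K) - ((s⁻¹) 0 : Kˣ) = -(((s 1 : K))⁻¹ * ((s 0 : K))⁻¹ * ((s 1 : K) - s 0)) := by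
        simp only [Pi.inv_apply, Units.val_inv_eq_inv_val]; field_simp; ring
      rw [e, Valuation.map_neg, map_mul, map_mul, map_inv₀, map_inv₀, hs1 0, hs1 1, inv_one, one_mul, one_mul]; exact hsa
    · have e : (((s⁻¹) 2 : Kˣ) : K) - ((s⁻¹) 1 : Kˣ) = -(((s 2 : K))⁻¹ * ((s 1 : K))⁻¹ * ((s 2 : K) - s 1)) := by
        simp only [Pi.inv_apply, Units.val_inv_eq_inv_val]; field_simp; ring
      rw [e, Valuation.map_neg, map_mul, map_mul, map_inv₀, map_inv₀, hs1 1, hs1 2, inv_one, one_mul, one_mul]; exact hsb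

/-- **(PT-2) `D(ρ,t) ≤ S̃(latt V(1,1,g))`**: a unit diagonal with `|s₁ − s₀| ≤ |ϖ|^{2ρ}` and `|s₂ − s₁| ≤ |ϖ|^{2ρ+2t}` stabilises the glued representative — conditions (a), (b) of
★ `mem_latticeStabilizer_latt_glued_exp_iff` a fortiori and the corner `|(s₂−s₁) + g(s₂−s₀)| ≤ |ϖ|^{2ρ+2t}` from `|g| = |ϖ|^{2t}`, `|s₂−s₀| ≤ |ϖ|^{2ρ}`.
[cite: Kottwitz1986BaseChangeUnits, §1 pp. 240–241] -/
theorem deepRatioSubgroup_le_unitStabilizer_glued_rep {ϖ : K} (hϖ0 : ϖ ≠ 0) (hϖ1 : Valued.v ϖ ≤ 1) (ρ t : ℕ) {g : K}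
    (hg : Valued.v g = Valued.v ϖ ^ (2 * t)) (V : GL (Fin 3) K)
    (hV : (V : Matrix (Fin 3) (Fin 3) K) = !![1, 0, 0; 1, ϖ ^ ρ, 0; 1 * 1 + g, ϖ ^ ρ * 1, ϖ ^ (2 * ρ + 2 * t)])
    {D : Subgroup (Fin 3 → Kˣ)} (hD : ∀ s : Fin 3 → Kˣ, s ∈ D ↔
      (∀ i, Valued.v (s i : K) = 1) ∧ Valued.v ((s 1 : K) - s 0) ≤ Valued.v ϖ ^ (2 * ρ) ∧ Valued.v ((s 2 : K) - s 1) ≤ Valued.v ϖ ^ (2 * ρ + 2 * t)) :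
    D ≤ unitStabilizer (latt (V : Matrix (Fin 3) (Fin 3) K)) := by
  intro s hs
  obtain ⟨hs1, hsa, hsb⟩ := (hD s).1 hs
  rw [F0P3cDyRamDiagonalTorusDefs.mem_unitStabilizer_iff]
  refine ⟨?_, hs1⟩
  rw [← F0P3cDyRamDiagonalTorusDefs.mem_latticeStabilizer_iff,
    mem_latticeStabilizer_latt_glued_exp_iff hϖ0 ρ (2 * t) (x := 1) (ζ := 1) (y'' := g) (by simp) (by simp) V hV s hs1]
  refine ⟨hsa.trans (pow_le_pow_right_of_le_one' hϖ1 (by omega)), hsb.trans (pow_le_pow_right_of_le_one' hϖ1 (by omega)), ?_⟩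
  rw [one_mul, one_mul]
  refine Valuation.map_add_le _ hsb ?_
  have h20 : Valued.v ((s 2 : K) - s 0) ≤ Valued.v ϖ ^ (2 * ρ) := by
    rw [show ((s 2 : K)) - s 0 = ((s 2 : K) - s 1) + ((s 1 : K) - s 0) by ring]
    exact Valuation.map_add_le _ (hsb.trans (pow_le_pow_right_of_le_one' hϖ1 (by omega))) hsa
  rw [map_mul, hg, show Valued.v ϖ ^ (2 * ρ + 2 * t) = Valued.v ϖ ^ (2 * t) * Valued.v ϖ ^ (2 * ρ) by rw [← pow_add]; ring_nf]
  exact mul_le_mul_right h20 _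

/-- **`N₀ := N(D) ≤ N′ := N(S̃(latt V))`** — ★ p860847's binder `hN₀` for the PRODUCT norm subgroup `N₀ = D.map (unitNormMap σ 3)`
(`= N(U_E) × N(U_E^{[2ρ]}) × N(U_E^{[2ρ+2t]})` in the coordinates `(u₀, u₁∕u₀, u₂∕u₁)`). [cite: Kottwitz1986BaseChangeUnits, §1 pp. 240–241] [cite: Serre1979, Ch. V §3] -/
theorem map_deepRatioSubgroup_le_map_unitStabilizer_glued_rep (σ : K →+* K) {ϖ : K} (hϖ0 : ϖ ≠ 0) (hϖ1 : Valued.v ϖ ≤ 1) (ρ t : ℕ) {g : K}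
    (hg : Valued.v g = Valued.v ϖ ^ (2 * t)) (V : GL (Fin 3) K)
    (hV : (V : Matrix (Fin 3) (Fin 3) K) = !![1, 0, 0; 1, ϖ ^ ρ, 0; 1 * 1 + g, ϖ ^ ρ * 1, ϖ ^ (2 * ρ + 2 * t)])
    {D : Subgroup (Fin 3 → Kˣ)} (hD : ∀ s : Fin 3 → Kˣ, s ∈ D ↔
      (∀ i, Valued.v (s i : K) = 1) ∧ Valued.v ((s 1 : K) - s 0) ≤ Valued.v ϖ ^ (2 * ρ) ∧ Valued.v ((s 2 : K) - s 1) ≤ Valued.v ϖ ^ (2 * ρ + 2 * t)) :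
    D.map (unitNormMap σ 3) ≤ (unitStabilizer (latt (V : Matrix (Fin 3) (Fin 3) K))).map (unitNormMap σ 3) :=
  Subgroup.map_mono (deepRatioSubgroup_le_unitStabilizer_glued_rep hϖ0 hϖ1 ρ t hg V hV hD)

end Summit.HodgeConjecture.HodgeConjecture.Cruxes.H413.F0P3cDyRamGluedDeepRatioSubgroup

end
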